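import Summits.QuantumAdvantage.QuantumAdvantage.Theorems.ResponseDialD

/-! # ResponseDialE — part 5/5 (mechanical split for landing of `ResponseDial`; content verbatim; scopes re-opened with their variables) -/

set_option linter.dupNamespace false
noncomputable section
open scoped Classical

namespace Summit.QuantumAdvantage.QuantumAdvantage.Theorems.ResponseDial
open Finset
open Literature.Computability.QuantumComplexity Literature.Computability.QuantumComplexity.RingHLF
open Literature.Computability.MetaComplexity Literature.Computability.MetaComplexity.Smolensky
open Summit.QuantumAdvantage.AdviceFreeQNC0
open Summit.QuantumAdvantage.QuantumAdvantage.Theorems.AnchorDial (outB dev cN orbF orbL orbL_cons fz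
  cN_orbF_cast oddZeros_orbF win_iff gCond_iff_cN card_filter_orbF orbF_false flip2 card_odd_ge loss_shape_mono)
open Summit.QuantumAdvantage.QuantumAdvantage.Theorems.AnchorDial.Core (ct sg)
open Summit.QuantumAdvantage.QuantumAdvantage.Theorems.HolonomyDial (gCond tPoly tPoly_apply tPoly_mem card_odd_le
  xorP xorP_mem xorP_apply_bool mono_singleton_apply indP indP_mem indP_apply)
open Summit.QuantumAdvantage.QuantumAdvantage.Theorems.StabilizerDial (apIdx apStrat apStrat_mem bitP bitP_apStrat
  pad rel_pad_iff outB_pad_zero pad_mem StabFew rowMask bitP_pad mem_dev_pad_apStrat_iff BlockRec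
  blockSelect_of_fewLocus goodBound_of_blockRec fibreIdentityAt_of_block oddSliceBound_holds eventually_polylog
  side_bounds)
open Summit.QuantumAdvantage.QuantumAdvantage.Theorems.LocusDial (Coverable FewLocus)
open Summit.QuantumAdvantage.QuantumAdvantage.Theorems.SparsityDial (real_loss_of_frac AntipodalLoss3 stabFew_mono_mr
  one_le_logpow)
open Summit.QuantumAdvantage.QuantumAdvantage.Theses.SparsityDial (DenseGenericLoss3)

/-! ## §8  WHERE THE DIAL CUTS: the antipodal family is in piece A's class (decided), the half-counter family responds
non-additively everywhere (piece A's law is silent on it). -/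

section Cut
variable {N : ℕ}

/-- the zero gauge changes no deviation set. -/
theorem dev_pad_zero (P : Fin N → CubeFn (ZMod 3) N) (x : Fin N → Bool) :
    dev (pad P (fun _ => 0)) x = dev P x := by
  ext i
  have h := congrFun (outB_pad_zero P x) i
  simp only [outB] at h
  simp only [Summit.QuantumAdvantage.QuantumAdvantage.Theorems.AnchorDial.dev, mem_filter, mem_univ, true_and, h]

/-- ResponseDialE helper `addResp_pad_zero_iff` (decomp-qadv land package; see the module docstring). -/
theorem addResp_pad_zero_iff (b : Fin 5 → ℕ) (P : Fin N → CubeFn (ZMod 3) N) (R : Fin 5 → Finset (Fin N))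
    (x : Fin N → Bool) : AddResp b (pad P (fun _ => 0)) R x ↔ AddResp b P R x := by
  unfold AddResp
  simp only [dev_pad_zero]

/-- **the antipodal family is CHEAPLY ADDITIVIZABLE** (zero gauge, sites `apSite n`, EVERY input): piece A's class
meets `DenseGenericLoss3`'s class in a certified-dense family — the dial cuts INSIDE the dense class. -/
theorem apStrat_stabAdd (n e : ℕ) (hn : 22 ≤ n) : StabAdd e (fun i : Fin n => apStrat i) := by
  refine ⟨fun _ => 0, fun _ => Submodule.zero_mem _, apSite n, ⟨apSite_sep n, apSite_le n hn⟩, ?_⟩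
  have h0 : (univ.filter fun x : Fin n → Bool => OddZeros x ∧
      ¬ ∃ R : Fin 5 → Finset (Fin n), AddResp (apSite n) (pad (fun i : Fin n => apStrat i) (fun _ => 0)) R x) = ∅ := by
    rw [Finset.filter_eq_empty_iff]
    intro x _ h
    exact h.2 ⟨apResp n, (addResp_pad_zero_iff _ _ _ x).2 (apStrat_addResp n x)⟩
  rw [h0, card_empty, Nat.mul_zero]
  exact Nat.zero_le _

/-! ### non-additivity of the half-counter family -/

/-- ResponseDialE helper `lodd_eq_sum` (decomp-qadv land package; see the module docstring). -/
theorem lodd_eq_sum (x : Fin N → Bool) :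
    (lodd : CubeFn (ZMod 3) N) x =
      ∑ j ∈ (univ : Finset (Fin N)).filter (fun j => j.val % 2 = 1), (if x j then (1 : ZMod 3) else 0) := by
  unfold lodd; rw [Finset.sum_apply]; exact sum_congr rfl fun j _ => mono_singleton_apply j x

/-- the odd-indexed cell of the `i`-th flipped pair `{b_i, b_i + 1}`. -/
def oddSite {b : Fin 5 → ℕ} (hbN : ∀ i, b i + 3 ≤ N) (i : Fin 5) : Fin N :=
  ⟨if b i % 2 = 1 then b i else b i + 1, by have := hbN i; split_ifs <;> omega⟩

/-- ResponseDialE helper `oddSite_odd` (decomp-qadv land package; see the module docstring). -/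
theorem oddSite_odd {b : Fin 5 → ℕ} (hbN : ∀ i, b i + 3 ≤ N) (i : Fin 5) : (oddSite hbN i).val % 2 = 1 := by
  unfold oddSite; dsimp only; split_ifs <;> omega

/-- ResponseDialE helper `oddSite_val` (decomp-qadv land package; see the module docstring). -/
theorem oddSite_val {b : Fin 5 → ℕ} (hbN : ∀ i, b i + 3 ≤ N) (i : Fin 5) :
    (oddSite hbN i).val = b i ∨ (oddSite hbN i).val = b i + 1 := by
  unfold oddSite; dsimp only; split_ifs <;> simp

/-- a flipped odd cell moves the counter by `+1` if it held `0`, by `−1` if it held `1`. -/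
def sgn3 (v : Bool) : ZMod 3 := if v then 2 else 1

/-- ResponseDialE helper `sgn3_ne` (decomp-qadv land package; see the module docstring). -/
theorem sgn3_ne (v : Bool) : sgn3 v ≠ 0 := by unfold sgn3; cases v <;> decide

/-- **the counter along a pair-flip orbit**: `Σodd(x^ε) = Σodd(x) + Σ_{i ∈ ε} sgn3 (x at the odd cell of pair i)`. -/
theorem lodd_orbF {b : Fin 5 → ℕ} (hb : ∀ i j : Fin 5, i < j → b i + 2 ≤ b j) (hbN : ∀ i, b i + 3 ≤ N)
    (ε : Fin 5 → Bool) (x : Fin N → Bool) :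
    (lodd : CubeFn (ZMod 3) N) (orbF b ε x) =
      (lodd : CubeFn (ZMod 3) N) x +
        ∑ i ∈ (univ : Finset (Fin 5)).filter (fun i => ε i = true), sgn3 (x (oddSite hbN i)) := by
  rw [lodd_eq_sum, lodd_eq_sum]
  have hpt : ∀ j ∈ (univ : Finset (Fin N)).filter (fun j => j.val % 2 = 1),
      (if orbF b ε x j then (1 : ZMod 3) else 0) =
        (if x j then (1 : ZMod 3) else 0) +
          (if (∃ i, ε i = true ∧ (j.val = b i ∨ j.val = b i + 1)) then sgn3 (x j) else 0) := by
    intro j _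
    rw [orbF_apply hb ε x j]
    by_cases h : ∃ i, ε i = true ∧ (j.val = b i ∨ j.val = b i + 1)
    · rw [if_pos h, if_pos h]; unfold sgn3; cases x j <;> decide
    · rw [if_neg h, if_neg h, add_zero]
  rw [sum_congr rfl hpt, sum_add_distrib]
  congr 1
  have hset : ((univ : Finset (Fin N)).filter (fun j => j.val % 2 = 1)).filter
      (fun j => ∃ i, ε i = true ∧ (j.val = b i ∨ j.val = b i + 1)) =
        ((univ : Finset (Fin 5)).filter (fun i => ε i = true)).image (oddSite hbN) := by
    ext j
    simp only [mem_filter, mem_univ, true_and, mem_image]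
    constructor
    · rintro ⟨hodd, i, hi, hj⟩
      refine ⟨i, hi, Fin.ext ?_⟩
      have h1 := oddSite_val hbN i
      have h2 := oddSite_odd hbN i
      rcases hj with hj | hj <;> rcases h1 with h1 | h1 <;> omega
    · rintro ⟨i, hi, rfl⟩
      exact ⟨oddSite_odd hbN i, i, hi, oddSite_val hbN i⟩
  rw [← sum_filter, hset, sum_image]
  intro i₁ hi₁ i₂ hi₂ heq
  by_contra hne
  have hv := congrArg Fin.val heq
  have h1 := oddSite_val hbN i₁
  have h2 := oddSite_val hbN i₂
  rcases lt_or_gt_of_ne hne with hlt | hlt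
  · have := hb i₁ i₂ hlt; omega
  · have := hb i₂ i₁ hlt; omega

/-- among five bits three agree. -/
theorem three_equal (v : Fin 5 → Bool) : ∃ i j k : Fin 5, i < j ∧ j < k ∧ v i = v j ∧ v j = v k := by
  rw [eq_vec5 v]
  generalize v 0 = a₀; generalize v 1 = a₁; generalize v 2 = a₂; generalize v 3 = a₃; generalize v 4 = a₄
  cases a₀ <;> cases a₁ <;> cases a₂ <;> cases a₃ <;> cases a₄ <;> decide

/-- the finite core of the non-additivity: `[L ≡ 0], [L+d ≡ 0], [L+2d ≡ 0]` cannot satisfy the affine relations. -/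
theorem counter_not_affine (L d : ZMod 3) (hd : d ≠ 0) (ρ₁ ρ₂ ρ₃ : Bool) :
    ¬ ((decide (L + d = 0) = true ↔ (decide (L = 0) = true ↔ ρ₁ = false)) ∧
       (decide (L + d = 0) = true ↔ (decide (L = 0) = true ↔ ρ₂ = false)) ∧
       (decide (L + d = 0) = true ↔ (decide (L = 0) = true ↔ ρ₃ = false)) ∧
       (decide (L + (d + d) = 0) = true ↔ (decide (L = 0) = true ↔ xor ρ₁ ρ₂ = false)) ∧
       (decide (L + (d + (d + d)) = 0) = true ↔ (decide (L = 0) = true ↔ xor ρ₁ (xor ρ₂ ρ₃) = false))) := by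
  revert L d ρ₁ ρ₂ ρ₃; decide

/-- **(b) THE HALF-COUNTER FAMILY RESPONDS NON-ADDITIVELY at EVERY input along EVERY admissible 5-orbit**
(so the additive-response law says nothing about it).  Proof: at position `N − 1` the deviation bit is the counter bit;
three of the five flipped odd cells hold the same value, so flipping 1, 2, 3 of them moves the counter by `d, 2d, 3d ≡ 0`;
an additive response would make `[L ≡ 0] = [L + d ≡ 0] = [L + 2d ≡ 0]` (`counter_not_affine`). -/
theorem hcStrat_not_addResp (hN : 8 ≤ N) {b : Fin 5 → ℕ} (hb : Sites N b) (x : Fin N → Bool)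
    (R : Fin 5 → Finset (Fin N)) : ¬ AddResp b (fun i : Fin N => hcStrat i) R x := by
  obtain ⟨hsep, hbN⟩ := hb
  intro hadd
  let k₀ : Fin N := ⟨N - 1, by omega⟩
  have hk₀ : ¬ (1 ≤ k₀.val ∧ k₀.val < N / 2) := by
    show ¬ (1 ≤ N - 1 ∧ N - 1 < N / 2); omega
  have hq : ∀ ε : Fin 5 → Bool, qbit (orbF b ε x) = true ↔ (qbit x = true ↔
      (univ.filter fun i : Fin 5 => ε i = true ∧ k₀ ∈ R i).card % 2 = 0) := by
    intro ε
    rw [← mem_dev_hcStrat_iff (orbF b ε x) k₀ hk₀, ← mem_dev_hcStrat_iff x k₀ hk₀]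
    exact hadd ε k₀
  have hqb : ∀ ε : Fin 5 → Bool, qbit (orbF b ε x) =
      decide ((lodd : CubeFn (ZMod 3) N) x +
        ∑ i ∈ (univ : Finset (Fin 5)).filter (fun i => ε i = true), sgn3 (x (oddSite hbN i)) = 0) := by
    intro ε; unfold qbit; rw [lodd_orbF hsep hbN]
  obtain ⟨i, j, k, hij, hjk, hvij', hvjk'⟩ := three_equal (fun l => x (oddSite hbN l))
  have hvij : x (oddSite hbN i) = x (oddSite hbN j) := hvij'
  have hvjk : x (oddSite hbN j) = x (oddSite hbN k) := hvjk'
  have hij' : i ≠ j := ne_of_lt hij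
  have hjk' : j ≠ k := ne_of_lt hjk
  have hik' : i ≠ k := ne_of_lt (lt_trans hij hjk)
  have hdj : sgn3 (x (oddSite hbN j)) = sgn3 (x (oddSite hbN i)) := by rw [hvij]
  have hdk : sgn3 (x (oddSite hbN k)) = sgn3 (x (oddSite hbN i)) := by rw [← hvjk, hvij]
  set L := (lodd : CubeFn (ZMod 3) N) x with hLdef
  have key : ∀ (S : Finset (Fin 5)),
      ((univ : Finset (Fin 5)).filter fun l => decide (l ∈ S) = true) = S := by
    intro S; ext l; simp
  have keyR : ∀ (S : Finset (Fin 5)),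
      ((univ : Finset (Fin 5)).filter fun l => decide (l ∈ S) = true ∧ k₀ ∈ R l) = S.filter fun l => k₀ ∈ R l := by
    intro S; ext l; simp
  have E : ∀ (S : Finset (Fin 5)), decide (L + ∑ l ∈ S, sgn3 (x (oddSite hbN l)) = 0) = true ↔
      (decide (L = 0) = true ↔ (S.filter fun l => k₀ ∈ R l).card % 2 = 0) := by
    intro S
    have h := hq (fun l => decide (l ∈ S))
    rw [hqb, key S, keyR S] at h
    exact h
  have e1 := E {i}
  have e2 := E {j}
  have e3 := E {k}
  have e12 := E {i, j}
  have e123 := E {i, j, k}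
  rw [sum_singleton] at e1 e2 e3
  rw [sum_pair hij'] at e12
  rw [sum_insert (by simp [hij', hik']), sum_pair hjk'] at e123
  rw [hdj] at e2 e12 e123
  rw [hdk] at e3 e123
  have c1 : ((({i} : Finset (Fin 5)).filter fun l => k₀ ∈ R l).card % 2 = 0) ↔ decide (k₀ ∈ R i) = false := by
    by_cases h1 : k₀ ∈ R i <;> simp [filter_singleton, h1]
  have c2 : ((({j} : Finset (Fin 5)).filter fun l => k₀ ∈ R l).card % 2 = 0) ↔ decide (k₀ ∈ R j) = false := by
    by_cases h2 : k₀ ∈ R j <;> simp [filter_singleton, h2]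
  have c3 : ((({k} : Finset (Fin 5)).filter fun l => k₀ ∈ R l).card % 2 = 0) ↔ decide (k₀ ∈ R k) = false := by
    by_cases h3 : k₀ ∈ R k <;> simp [filter_singleton, h3]
  have c12 : ((({i, j} : Finset (Fin 5)).filter fun l => k₀ ∈ R l).card % 2 = 0) ↔
      xor (decide (k₀ ∈ R i)) (decide (k₀ ∈ R j)) = false := by
    by_cases h1 : k₀ ∈ R i <;> by_cases h2 : k₀ ∈ R j <;>
      simp [filter_insert, filter_singleton, h1, h2, hij']
  have c123 : ((({i, j, k} : Finset (Fin 5)).filter fun l => k₀ ∈ R l).card % 2 = 0) ↔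
      xor (decide (k₀ ∈ R i)) (xor (decide (k₀ ∈ R j)) (decide (k₀ ∈ R k))) = false := by
    by_cases h1 : k₀ ∈ R i <;> by_cases h2 : k₀ ∈ R j <;> by_cases h3 : k₀ ∈ R k <;>
      simp [filter_insert, filter_singleton, h1, h2, h3, hij', hjk', hik']
  rw [c1] at e1
  rw [c2] at e2
  rw [c3] at e3
  rw [c12] at e12
  rw [c123] at e123
  exact counter_not_affine L (sgn3 (x (oddSite hbN i))) (sgn3_ne _) _ _ _ ⟨e1, e2, e3, e12, e123⟩

/-- hence the zero gauge NEVER additivizes the half-counter family (at no site tuple, at no input); whether some other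
cheap gauge does is the open question E3 of the memo (the continuant automaton). -/
theorem hcStrat_not_addResp_pad_zero (hN : 8 ≤ N) {b : Fin 5 → ℕ} (hb : Sites N b) (x : Fin N → Bool) :
    ¬ ∃ R : Fin 5 → Finset (Fin N), AddResp b (pad (fun i : Fin N => hcStrat i) (fun _ => 0)) R x := by
  rintro ⟨R, hR⟩
  exact hcStrat_not_addResp hN hb x R ((addResp_pad_zero_iff b _ R x).1 hR)

end Cut


end Summit.QuantumAdvantage.QuantumAdvantage.Theorems.ResponseDial
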